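import Summits.Ventures.PercRepro.ExcessOneMerge

/-!
# (Θ) through its three transversals: the six-colour symmetry and the wrong-way-difference bound

Dossier proofs/MINE1-theoremS.md, Addendum 69 (mine-1, gen 37). For a (Θ)-instance `(A, B, C)`
the family `T = A ∪ B ∪ C ∪ A* ∪ B* ∪ C*` splits into the three **transversals**
`F₁ = A ∪ C*`, `F₂ = B ∪ A*`, `F₃ = C ∪ B*` (`transversal A C`, `transversal B A`,
`transversal C B`), each a two-type Marica–Schönheim family, and

* `thetaD_eq_union_diffs_transversal`: `thetaD A B C = D(F₁) ∪ D(F₂) ∪ D(F₃)`.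

In the six-colour picture (colours `A, C*, B, A*, C, B*` around a 6-cycle, complementation = the
antipodal map) `thetaD` is the family of meets of pairs at cyclic distance `≥ 2`, so it carries the
dihedral symmetry of the 6-cycle: the rotation `thetaD_rotate` (ThetaSet.lean), the reflection
`thetaD_swap` (`(A, B, C) ↦ (A, C, B)`) and the antipodal map `thetaD_compls`
(`(A, B, C) ↦ (A*, B*, C*)`), with the validity transports `thetaValid_swap`, `thetaValid_compls`.

The **half family** `H = A ∪ C* ∪ B*` (three consecutive colours) has `|H| = |A| + |B| + |C|` by
validity and `D(H) ⊆ thetaD A B C ∪ (B \\ C) ∪ (C \\ B)` — every difference of `H` is a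
(Θ)-difference except the «wrong-way» differences between `B` and `C` — so Marica–Schönheim on
`H` gives the **wrong-way bound** `card_le_card_thetaD_add_wrong`:
`|A| + |B| + |C| ≤ |thetaD A B C| + |((B \\ C) ∪ (C \\ B)) \ thetaD A B C|`, and hence (Θ) in
the regime where the wrong-way differences of some pair of types are (Θ)-differences
(`theta_card_le_of_wrong_diffs_subset` and its two rotations).
-/

namespace PercRepro.MSTight

open Finset
open scoped FinsetFamily

variable {α : Type*} [DecidableEq α] [Fintype α]

section Compls

/-- Differences of complement families are the reversed differences: `A* \\ B* = B \\ A`. -/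
theorem diffs_compls_compls (A B : Finset (Finset α)) : compls A \\ compls B = B \\ A := by
  ext x
  simp only [mem_diffs, mem_compls]
  constructor
  · rintro ⟨t, ht, s, hs, rfl⟩
    refine ⟨Finset.univ \ s, hs, Finset.univ \ t, ht, ?_⟩
    ext a; simp only [mem_sdiff, mem_univ, true_and, not_not]; tauto
  · rintro ⟨b, hb, a, ha, rfl⟩
    refine ⟨Finset.univ \ a, ?_, Finset.univ \ b, ?_, ?_⟩
    · rw [Finset.sdiff_sdiff_eq_self (subset_univ a)]; exact ha
    · rw [Finset.sdiff_sdiff_eq_self (subset_univ b)]; exact hb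
    · ext i; simp only [mem_sdiff, mem_univ, true_and, not_not]; tauto

/-- Meets of complement families are complements of joins: `A* ⊼ B* = (A ⊻ B)*`. -/
theorem infs_compls_compls (A B : Finset (Finset α)) :
    compls A ⊼ compls B = compls (A ⊻ B) := by
  ext x
  simp only [mem_infs, mem_sups, mem_compls]
  constructor
  · rintro ⟨s, hs, t, ht, rfl⟩
    refine ⟨Finset.univ \ s, hs, Finset.univ \ t, ht, ?_⟩
    rw [sup_eq_union, inf_eq_inter]
    ext i; simp only [mem_union, mem_sdiff, mem_inter, mem_univ, true_and, not_and]; tauto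
  · rintro ⟨a, ha, b, hb, h⟩
    refine ⟨Finset.univ \ a, ?_, Finset.univ \ b, ?_, ?_⟩
    · rw [Finset.sdiff_sdiff_eq_self (subset_univ a)]; exact ha
    · rw [Finset.sdiff_sdiff_eq_self (subset_univ b)]; exact hb
    · have hx : x = Finset.univ \ (a ⊔ b) := by
        rw [h, Finset.sdiff_sdiff_eq_self (subset_univ x)]
      rw [hx, sup_eq_union, inf_eq_inter]
      ext i; simp only [mem_union, mem_sdiff, mem_inter, mem_univ, true_and, not_or]

/-- Complements of joins of complement families are meets: `(A* ⊻ B*)* = A ⊼ B`. -/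
theorem compls_sups_compls_compls (A B : Finset (Finset α)) :
    compls (compls A ⊻ compls B) = A ⊼ B := by
  rw [← infs_compls_compls, compls_compls, compls_compls]

/-- Differences against a complement family are meets: `A \\ C* = A ⊼ C`. -/
theorem diffs_compls_eq_infs (A C : Finset (Finset α)) : A \\ compls C = A ⊼ C := by
  ext x
  simp only [mem_diffs, mem_infs, mem_compls]
  constructor
  · rintro ⟨a, ha, s, hs, rfl⟩
    refine ⟨a, ha, Finset.univ \ s, hs, ?_⟩
    rw [inf_eq_inter]
    ext i; simp only [mem_sdiff, mem_inter, mem_univ, true_and]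
  · rintro ⟨a, ha, c, hc, rfl⟩
    refine ⟨a, ha, Finset.univ \ c, ?_, ?_⟩
    · rw [Finset.sdiff_sdiff_eq_self (subset_univ c)]; exact hc
    · rw [inf_eq_inter]
      ext i; simp only [mem_sdiff, mem_inter, mem_univ, true_and, not_not]

/-- `compls` preserves disjointness. -/
theorem disjoint_compls_compls {A B : Finset (Finset α)} (h : Disjoint A B) :
    Disjoint (compls A) (compls B) := by
  rw [disjoint_left] at h ⊢
  intro x hxA hxB
  exact h (mem_compls.1 hxA) (mem_compls.1 hxB)

end Compls

section Symmetry

variable (A B C : Finset (Finset α))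

/-- **The three transversals**: `thetaD A B C = D(A ∪ C*) ∪ D(B ∪ A*) ∪ D(C ∪ B*)`. -/
theorem thetaD_eq_union_diffs_transversal :
    thetaD A B C = transversal A C \\ transversal A C ∪ transversal B A \\ transversal B A ∪
      transversal C B \\ transversal C B := by
  apply Subset.antisymm
  · intro E hE
    have h1 : transversal A C \\ transversal A C ⊆ transversal A C \\ transversal A C ∪
        transversal B A \\ transversal B A ∪ transversal C B \\ transversal C B :=
      subset_union_left.trans subset_union_left
    have h2 : transversal B A \\ transversal B A ⊆ transversal A C \\ transversal A C ∪
        transversal B A \\ transversal B A ∪ transversal C B \\ transversal C B :=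
      subset_union_right.trans subset_union_left
    have h3 : transversal C B \\ transversal C B ⊆ transversal A C \\ transversal A C ∪
        transversal B A \\ transversal B A ∪ transversal C B \\ transversal C B :=
      subset_union_right
    have hA : A ⊆ transversal A C := subset_union_left
    have hB : B ⊆ transversal B A := subset_union_left
    have hC : C ⊆ transversal C B := subset_union_left
    have hA' : compls A ⊆ transversal B A := subset_union_right
    have hB' : compls B ⊆ transversal C B := subset_union_right
    have hC' : compls C ⊆ transversal A C := subset_union_right
    unfold thetaD at hE
    simp only [mem_union] at hE
    rcases hE with ((((((((hE | hE) | hE) | hE) | hE) | hE) | hE) | hE) | hE)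
    · exact h1 (diffs_subset hA hA hE)
    · exact h2 (diffs_subset hB hB hE)
    · exact h3 (diffs_subset hC hC hE)
    · -- `a ⊓ b = b \ aᶜ ∈ D(F₂)`
      obtain ⟨a, ha, b, hb, rfl⟩ := mem_infs.1 hE
      refine h2 (mem_diffs.2 ⟨b, hB hb, Finset.univ \ a, hA' (compl_mem_compls ha), ?_⟩)
      rw [inf_eq_inter]
      ext i; simp only [mem_sdiff, mem_inter, mem_univ, true_and, not_not]; tauto
    · -- `b ⊓ c = c \ bᶜ ∈ D(F₃)`
      obtain ⟨b, hb, c, hc, rfl⟩ := mem_infs.1 hE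
      refine h3 (mem_diffs.2 ⟨c, hC hc, Finset.univ \ b, hB' (compl_mem_compls hb), ?_⟩)
      rw [inf_eq_inter]
      ext i; simp only [mem_sdiff, mem_inter, mem_univ, true_and, not_not]; tauto
    · -- `c ⊓ a = a \ cᶜ ∈ D(F₁)`
      obtain ⟨c, hc, a, ha, rfl⟩ := mem_infs.1 hE
      refine h1 (mem_diffs.2 ⟨a, hA ha, Finset.univ \ c, hC' (compl_mem_compls hc), ?_⟩)
      rw [inf_eq_inter]
      ext i; simp only [mem_sdiff, mem_inter, mem_univ, true_and, not_not]; tauto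
    · -- `(a ⊔ b)ᶜ = aᶜ \ b ∈ D(F₂)`
      obtain ⟨a, ha, b, hb, hab⟩ := mem_sups.1 (mem_compls.1 hE)
      refine h2 (mem_diffs.2 ⟨Finset.univ \ a, hA' (compl_mem_compls ha), b, hB hb, ?_⟩)
      have hx : E = Finset.univ \ (a ⊔ b) := by
        rw [hab, Finset.sdiff_sdiff_eq_self (subset_univ E)]
      rw [hx, sup_eq_union]
      ext i; simp only [mem_sdiff, mem_union, mem_univ, true_and, not_or]
    · -- `(b ⊔ c)ᶜ = bᶜ \ c ∈ D(F₃)`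
      obtain ⟨b, hb, c, hc, hbc⟩ := mem_sups.1 (mem_compls.1 hE)
      refine h3 (mem_diffs.2 ⟨Finset.univ \ b, hB' (compl_mem_compls hb), c, hC hc, ?_⟩)
      have hx : E = Finset.univ \ (b ⊔ c) := by
        rw [hbc, Finset.sdiff_sdiff_eq_self (subset_univ E)]
      rw [hx, sup_eq_union]
      ext i; simp only [mem_sdiff, mem_union, mem_univ, true_and, not_or]
    · -- `(c ⊔ a)ᶜ = cᶜ \ a ∈ D(F₁)`
      obtain ⟨c, hc, a, ha, hca⟩ := mem_sups.1 (mem_compls.1 hE)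
      refine h1 (mem_diffs.2 ⟨Finset.univ \ c, hC' (compl_mem_compls hc), a, hA ha, ?_⟩)
      have hx : E = Finset.univ \ (c ⊔ a) := by
        rw [hca, Finset.sdiff_sdiff_eq_self (subset_univ E)]
      rw [hx, sup_eq_union]
      ext i; simp only [mem_sdiff, mem_union, mem_univ, true_and, not_or]
  · refine union_subset (union_subset ?_ ?_) ?_
    · exact diffs_transversal_subset A B C
    · have := diffs_transversal_subset B C A
      rwa [thetaD_rotate] at this
    · have := diffs_transversal_subset C A B
      rwa [thetaD_rotate, thetaD_rotate] at this

/-- **The reflection of the 6-cycle**: `thetaD A C B = thetaD A B C`. -/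
theorem thetaD_swap : thetaD A C B = thetaD A B C := by
  unfold thetaD
  rw [infs_comm (s := A) (t := C), infs_comm (s := C) (t := B), infs_comm (s := B) (t := A),
    sups_comm (s := A) (t := C), sups_comm (s := C) (t := B), sups_comm (s := B) (t := A)]
  ext E
  simp only [mem_union]
  tauto

/-- **The antipodal map of the 6-cycle**: `thetaD A* B* C* = thetaD A B C`. -/
theorem thetaD_compls : thetaD (compls A) (compls B) (compls C) = thetaD A B C := by
  unfold thetaD
  rw [diffs_compls_compls, diffs_compls_compls, diffs_compls_compls, infs_compls_compls,
    infs_compls_compls, infs_compls_compls, compls_sups_compls_compls, compls_sups_compls_compls,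
    compls_sups_compls_compls]
  ext E
  simp only [mem_union]
  tauto

variable {A B C}

/-- Validity is invariant under the reflection. -/
theorem thetaValid_swap (h : ThetaValid A B C) : ThetaValid A C B := by
  obtain ⟨hAA, hBB, hCC, hAB, hBC, hCA, hAB', hBC', hCA'⟩ := h
  exact ⟨hAA, hCC, hBB, hCA.symm, hBC.symm, hAB.symm, disjoint_compls_comm hCA',
    disjoint_compls_comm hBC', disjoint_compls_comm hAB'⟩

/-- Validity is invariant under the antipodal map. -/
theorem thetaValid_compls (h : ThetaValid A B C) :
    ThetaValid (compls A) (compls B) (compls C) := by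
  obtain ⟨hAA, hBB, hCC, hAB, hBC, hCA, hAB', hBC', hCA'⟩ := h
  refine ⟨?_, ?_, ?_, disjoint_compls_compls hAB, disjoint_compls_compls hBC,
    disjoint_compls_compls hCA, ?_, ?_, ?_⟩
  · rw [compls_compls]; exact hAA.symm
  · rw [compls_compls]; exact hBB.symm
  · rw [compls_compls]; exact hCC.symm
  · rw [compls_compls]; exact (disjoint_compls_comm hAB').symm
  · rw [compls_compls]; exact (disjoint_compls_comm hBC').symm
  · rw [compls_compls]; exact (disjoint_compls_comm hCA').symm

end Symmetry

section Half

variable {A B C : Finset (Finset α)}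

/-- The half family `H = A ∪ C* ∪ B*` (three consecutive colours of the 6-cycle). -/
def half (A B C : Finset (Finset α)) : Finset (Finset α) := A ∪ compls C ∪ compls B

/-- The half family has `|A| + |B| + |C|` members (validity). -/
theorem card_half (h : ThetaValid A B C) : (half A B C).card = A.card + B.card + C.card := by
  obtain ⟨-, -, -, -, hBC, -, hAB', -, hCA'⟩ := h
  unfold half
  rw [card_union_of_disjoint, card_union_of_disjoint (disjoint_compls_comm hCA'), card_compls,
    card_compls]
  · ring
  · rw [disjoint_union_left]
    exact ⟨hAB', disjoint_compls_compls hBC.symm⟩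

/-- **Every difference of the half family is a (Θ)-difference or a wrong-way difference between
`B` and `C`**: `D(H) ⊆ thetaD A B C ∪ (B \\ C) ∪ (C \\ B)`. -/
theorem diffs_half_subset (A B C : Finset (Finset α)) :
    half A B C \\ half A B C ⊆ thetaD A B C ∪ (B \\ C ∪ C \\ B) := by
  intro E hE
  obtain ⟨s, hs, t, ht, rfl⟩ := mem_diffs.1 hE
  unfold half at hs ht
  rw [mem_union, mem_union] at hs ht
  rcases hs with (hsA | hsC) | hsB <;> rcases ht with (htA | htC) | htB
  · exact mem_union_left _ (mem_thetaD_of_mem_diffs_left (mem_diffs.2 ⟨s, hsA, t, htA, rfl⟩))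
  · -- `a \ cᶜ = c ⊓ a`
    have hc := mem_compls.1 htC
    refine mem_union_left _ (mem_thetaD_of_mem_infs_CA (mem_infs.2 ⟨_, hc, s, hsA, ?_⟩))
    rw [inf_eq_inter]
    ext x; simp only [mem_inter, mem_sdiff, mem_univ, true_and]; tauto
  · -- `a \ bᶜ = a ⊓ b`
    have hb := mem_compls.1 htB
    refine mem_union_left _ (mem_thetaD_of_mem_infs_AB (mem_infs.2 ⟨s, hsA, _, hb, ?_⟩))
    rw [inf_eq_inter]
    ext x; simp only [mem_inter, mem_sdiff, mem_univ, true_and]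
  · -- `cᶜ \ a = (c ⊔ a)ᶜ`
    have hc := mem_compls.1 hsC
    refine mem_union_left _ (mem_thetaD_of_mem_compls_CA (mem_compls.2 ?_))
    refine mem_sups.2 ⟨_, hc, t, htA, ?_⟩
    rw [sup_eq_union]
    ext x; simp only [mem_union, mem_sdiff, mem_univ, true_and, not_not, not_and]; tauto
  · -- `cᶜ \ c'ᶜ = c' \ c`
    have hc := mem_compls.1 hsC
    have hc' := mem_compls.1 htC
    refine mem_union_left _ (mem_thetaD_of_mem_diffs_right (mem_diffs.2 ⟨_, hc', _, hc, ?_⟩))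
    ext x; simp only [mem_sdiff, mem_univ, true_and, not_not]; tauto
  · -- `cᶜ \ bᶜ = b \ c` — wrong-way
    have hc := mem_compls.1 hsC
    have hb := mem_compls.1 htB
    refine mem_union_right _ (mem_union_left _ (mem_diffs.2 ⟨_, hb, _, hc, ?_⟩))
    ext x; simp only [mem_sdiff, mem_univ, true_and, not_not]; tauto
  · -- `bᶜ \ a = (a ⊔ b)ᶜ`
    have hb := mem_compls.1 hsB
    refine mem_union_left _ (mem_thetaD_of_mem_compls_AB (mem_compls.2 ?_))
    refine mem_sups.2 ⟨t, htA, _, hb, ?_⟩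
    rw [sup_eq_union]
    ext x; simp only [mem_union, mem_sdiff, mem_univ, true_and, not_not, not_and]; tauto
  · -- `bᶜ \ cᶜ = c \ b` — wrong-way
    have hb := mem_compls.1 hsB
    have hc := mem_compls.1 htC
    refine mem_union_right _ (mem_union_right _ (mem_diffs.2 ⟨_, hc, _, hb, ?_⟩))
    ext x; simp only [mem_sdiff, mem_univ, true_and, not_not]; tauto
  · -- `bᶜ \ b'ᶜ = b' \ b`
    have hb := mem_compls.1 hsB
    have hb' := mem_compls.1 htB
    refine mem_union_left _ (mem_thetaD_of_mem_diffs_mid (mem_diffs.2 ⟨_, hb', _, hb, ?_⟩))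
    ext x; simp only [mem_sdiff, mem_univ, true_and, not_not]; tauto

/-- **The wrong-way bound**: the deficiency of (Θ) is at most the number of wrong-way differences
between `B` and `C` that are not (Θ)-differences,
`|A| + |B| + |C| ≤ |thetaD A B C| + |((B \\ C) ∪ (C \\ B)) \ thetaD A B C|`. -/
theorem card_le_card_thetaD_add_wrong (h : ThetaValid A B C) :
    A.card + B.card + C.card ≤
      (thetaD A B C).card + ((B \\ C ∪ C \\ B) \ thetaD A B C).card := by
  have hMS : (half A B C).card ≤ (half A B C \\ half A B C).card := card_le_card_diffs _
  have hsub := card_le_card (diffs_half_subset A B C)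
  have hcard : (thetaD A B C ∪ (B \\ C ∪ C \\ B)).card =
      ((B \\ C ∪ C \\ B) \ thetaD A B C).card + (thetaD A B C).card := by
    rw [card_sdiff_add_card, union_comm]
  rw [← card_half h]
  omega

/-- **(Θ) in the wrong-way regime for `B`, `C`**: if the differences `B \\ C` and `C \\ B` are
(Θ)-differences, then `|A| + |B| + |C| ≤ |thetaD A B C|`. -/
theorem theta_card_le_of_wrong_diffs_subset (h : ThetaValid A B C)
    (hBC : B \\ C ⊆ thetaD A B C) (hCB : C \\ B ⊆ thetaD A B C) :
    A.card + B.card + C.card ≤ (thetaD A B C).card := by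
  have := card_le_card_thetaD_add_wrong h
  have hW : (B \\ C ∪ C \\ B) \ thetaD A B C = ∅ :=
    sdiff_eq_empty_iff_subset.2 (union_subset hBC hCB)
  rw [hW, card_empty, add_zero] at this
  exact this

/-- The wrong-way regime for `C`, `A` (by the rotation). -/
theorem theta_card_le_of_wrong_diffs_subset_CA (h : ThetaValid A B C)
    (hCA : C \\ A ⊆ thetaD A B C) (hAC : A \\ C ⊆ thetaD A B C) :
    A.card + B.card + C.card ≤ (thetaD A B C).card := by
  have := theta_card_le_of_wrong_diffs_subset (thetaValid_rotate h)
    (by rwa [thetaD_rotate]) (by rwa [thetaD_rotate])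
  rw [thetaD_rotate] at this
  omega

/-- The wrong-way regime for `A`, `B` (by the rotation). -/
theorem theta_card_le_of_wrong_diffs_subset_AB (h : ThetaValid A B C)
    (hAB : A \\ B ⊆ thetaD A B C) (hBA : B \\ A ⊆ thetaD A B C) :
    A.card + B.card + C.card ≤ (thetaD A B C).card := by
  have := theta_card_le_of_wrong_diffs_subset (thetaValid_rotate (thetaValid_rotate h))
    (by rwa [thetaD_rotate, thetaD_rotate]) (by rwa [thetaD_rotate, thetaD_rotate])
  rw [thetaD_rotate, thetaD_rotate] at this
  omega

end Half

end PercRepro.MSTight
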